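import Literature.NumberTheory.EllipticCurves.OpenImageMazurCharacterProofs
import Literature.NumberTheory.GaloisRepresentations.DecompositionGroupOfCompletion
import Literature.NumberTheory.EllipticCurves.GreenbergSelmer
import HarnessLib

/-!
# Route `EisensteinPrimes`, crux 2 `GoodLatticeBDPValue` (stmt-BirchSwinnertonDyer-19032), line `halves`, AN-3 Stub B
# (`FullDescentAtThreeOfRed`), global input (G-ℚ): **ℚ has no non-trivial abelian extension unramified at every prime**
# — a continuous character of `Γ_ℚ` that kills every inertia group is trivial (KERNEL, from the tree's Kronecker–Weber)

Cell `bsd-eis` (home `run/shared/lean/pub/bsd-eis/`), width seat `bsd-line-x1-p1-w2` (gen 5; `--supports -19032`, closes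
nothing by itself). Stub F4 of the AN-3 road memo `HOME/line-x1-p1-w3-g4/AN3-StubB-elementary-road.md` (w3 gen 4, §4):
the global fact (G-ℚ) used twice in the elementary `E[9]` proof of Theorem T′ (idea-11 g9
`Cruxes/GoodLatticeBDPValue/Lines/halves_anThree_typedSplit_idea11g9.lean` §3, `FullDescentAtThreeOfRed`): in Lemma S′ (the
isogeny character of a curve good at `3` and semistable elsewhere is `𝟙` or `ω`) and in step A4 (the character of the
rational cyclic `9`-group `L ≤ E[9]` times `χ_cyc⁻¹` is trivial). Classically this is Minkowski's theorem (`|d_K| > 1` for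
`K ≠ ℚ`) for the ABELIAN case; here it is DERIVED, with no named fact, from the tree's PROVED Kronecker–Weber theorem
(`KroneckerWeber_holds`, Marcus Ch. 4 Ex. 29–36) and the tree's description of the absolute inertia groups of the
cyclotomic tower (`exists_mem_inertia_modNCyclotomicCharacter_eq`: `I_𝔓 ↠ ker((ℤ/p^{k+1}d)ˣ → (ℤ/d)ˣ)`):

* `factorsThrough_of_factorsThrough_mul` — if `ψ` factors through `χ_m`, `m = p^{k+1} d`, `p ∤ d`, and `ψ` kills an
  inertia group above `p`, then `ψ` factors through `χ_d`;
* `eq_one_of_factorsThrough_of_forall_inertia` — induction on `m`;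
* **`monoidHom_eq_one_of_forall_exists_inertia`** — for `ψ : Γ_ℚ →* M` (`M` commutative) with OPEN kernel such that
  for every finite place `v` SOME prime `𝔓 ∣ v` of `\bar ℤ` has `ψ(I_𝔓) = 1`: `ψ = 1`. The tree's
  `Mazur1978.monoidHom_eq_one_of_forall_inertia` (`OpenImageMazurCharacterProofs`, Cassels 10.12.1 route) is the form with
  the hypothesis at ALL primes `𝔓 ∣ v`; the one-prime-per-place form is what the local files (Tate at the multiplicative
  primes, Néron–Ogg–Shafarevich at the good ones, the ordinary filtration at `3`) deliver for the prime cut out by the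
  chosen embedding `ℚ̄ → ℚ̄_v`, and it is proved here directly by induction on the modulus (no conjugation of primes);
* `monoidHom_eq_one_of_forall_greenbergInertia` — the same with the hypothesis in the `GreenbergSelmer.inertia v`
  currency (the image of `absInertia ℚ_v` under `absGaloisRestrict`), through the tree bridge
  `inertia_adicCompletionPrime_eq_map_absInertia`.

HONEST FRAMING: helper theorems only (0 definitions, 0 named facts, 0 sorry); no summit statement, no BSD / IMC2 /
Keller–Yin theorem, no stub of the registered skeleton is proved here. References: [Washington1997] Thm. 14.1
(Kronecker–Weber); [NeukirchANT1999] Ch. III (2.17)–(2.18) (Minkowski: every `K ≠ ℚ` ramifies somewhere), Ch. I (10.3)–(10.4)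
(ramification in `ℚ(ζ_m)`); [SerreLocalFields1979] Ch. I §7 Prop. 22 (b), Ch. IV §4 Prop. 17–18.
-/

set_option autoImplicit false
-- the route's Theorems namespace repeats the summit name by design (D-0017 nested layout)
set_option linter.dupNamespace false

noncomputable section

open scoped Classical NumberField

namespace Summit.BirchSwinnertonDyer.BirchSwinnertonDyer.Theorems.FullDescentNoUnramifiedCharacter

open Function NumberField IsDedekindDomain Field Rat.HeightOneSpectrum
  Literature.NumberTheory.GaloisRepresentations Literature.NumberTheory.EllipticCurves

universe u

/-! ## §1. `ψ` factors through `χ_m` ⟹ through `χ_d`, when `ψ` kills an inertia group above `p`, `m = p^{k+1} d` -/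

/-- **Removing one prime from the modulus.** Let `ψ : Γ_ℚ → M` (commutative) factor through the mod `m` cyclotomic
character (`χ_m σ = 1 → ψ σ = 1`), `m = p^{k+1} d` with `p ∤ d`, and suppose `ψ` kills the inertia group `I_𝔓` of some
prime `𝔓` of `\bar ℤ` above `p`. Then `ψ` factors through `χ_d`: for `χ_d σ = 1` the unit `χ_m σ` lies in
`ker((ℤ/m)ˣ → (ℤ/d)ˣ) = χ_m(I_𝔓)` (`exists_mem_inertia_modNCyclotomicCharacter_eq`), so `σ = τ · (τ⁻¹σ)` with `τ ∈ I_𝔓` and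
`χ_m(τ⁻¹σ) = 1` (`χ_d = χ_m mod d`, `Mazur1978.unitsMap_modNCyclotomicCharacter`). [cite: NeukirchANT1999, Ch. I (10.3)–(10.4); Ch. II (9.4)–(9.5)] [cite: SerreLocalFields1979, Ch. I §7 Prop. 22 (b)] -/
theorem factorsThrough_of_factorsThrough_mul {M : Type*} [CommGroup M] (ψ : absoluteGaloisGroup ℚ →* M)
    {m p k d : ℕ} [NeZero m] [NeZero d] [hp : Fact p.Prime] (hm : m = p ^ (k + 1) * d) (hd : ¬ p ∣ d)
    (hψ : ∀ σ : absoluteGaloisGroup ℚ, modNCyclotomicCharacter ℚ m σ = 1 → ψ σ = 1)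
    {𝔓 : Ideal (absIntegers (𝓞 ℚ) ℚ)}
    (h𝔓 : 𝔓 ∈ ((primesEquiv (R := 𝓞 ℚ)).symm ⟨p, hp.out⟩ : HeightOneSpectrum (𝓞 ℚ)).primesAbove)
    (hI : ∀ τ ∈ 𝔓.inertia (absoluteGaloisGroup ℚ), ψ τ = 1) :
    ∀ σ : absoluteGaloisGroup ℚ, modNCyclotomicCharacter ℚ d σ = 1 → ψ σ = 1 := by
  intro σ hσ
  have hv : natGenerator ((primesEquiv (R := 𝓞 ℚ)).symm ⟨p, hp.out⟩ : HeightOneSpectrum (𝓞 ℚ)) = p := by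
    have := congrArg Subtype.val ((primesEquiv (R := 𝓞 ℚ)).apply_symm_apply ⟨p, hp.out⟩)
    exact this
  have ha : ZMod.unitsMap (Dvd.intro_left _ hm.symm) (modNCyclotomicCharacter ℚ m σ) = 1 := by
    rw [Mazur1978.unitsMap_modNCyclotomicCharacter (Dvd.intro_left _ hm.symm) σ, hσ]
  obtain ⟨τ, hτI, hτ⟩ := exists_mem_inertia_modNCyclotomicCharacter_eq (m := m) hm hd hv h𝔓 ha
  have h1 : modNCyclotomicCharacter ℚ m (τ⁻¹ * σ) = 1 := by
    rw [map_mul, map_inv, hτ, inv_mul_cancel]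
  have h2 : ψ (τ⁻¹ * σ) = 1 := hψ _ h1
  have h3 : σ = τ * (τ⁻¹ * σ) := by group
  rw [h3, map_mul, h2, mul_one]
  exact hI τ hτI

/-! ## §2. Induction on the modulus -/

/-- **A character factoring through `χ_m` and killing an inertia group above every prime is trivial** (induction on
`m`: strip the primes of `m` one at a time with `factorsThrough_of_factorsThrough_mul`; at `m = 1`, `χ_1` is trivial).
[cite: NeukirchANT1999, Ch. III (2.17)–(2.18)] [cite: Washington1997, Ch. 14, Thm. 14.1] -/
theorem eq_one_of_factorsThrough_of_forall_inertia {M : Type*} [CommGroup M] (ψ : absoluteGaloisGroup ℚ →* M)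
    (hI : ∀ (p : ℕ) (hp : p.Prime), ∃ 𝔓 ∈ ((primesEquiv (R := 𝓞 ℚ)).symm ⟨p, hp⟩ : HeightOneSpectrum (𝓞 ℚ)).primesAbove,
      ∀ τ ∈ 𝔓.inertia (absoluteGaloisGroup ℚ), ψ τ = 1) :
    ∀ (m : ℕ) [NeZero m], (∀ σ : absoluteGaloisGroup ℚ, modNCyclotomicCharacter ℚ m σ = 1 → ψ σ = 1) → ψ = 1 := by
  intro m
  induction m using Nat.strong_induction_on with
  | _ m ih =>
    intro _ hψ
    by_cases hm1 : m = 1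
    · subst hm1
      ext σ
      refine hψ σ (Subsingleton.elim _ _)
    · -- `m > 1`: strip its least prime factor
      have hm0 : m ≠ 0 := NeZero.ne m
      set p := m.minFac with hpdef
      haveI hp : Fact p.Prime := ⟨Nat.minFac_prime hm1⟩
      set e := m.factorization p with hedef
      have he : 1 ≤ e := by
        rw [hedef]
        exact (hp.out.dvd_iff_one_le_factorization hm0).mp (Nat.minFac_dvd m)
      obtain ⟨k, hk⟩ : ∃ k, e = k + 1 := ⟨e - 1, by omega⟩
      set d := m / p ^ e with hddef
      have hmd : m = p ^ (k + 1) * d := by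
        rw [← hk, hddef, hedef]
        exact (Nat.ordProj_mul_ordCompl_eq_self m p).symm
      have hpd : ¬ p ∣ d := by
        rw [hddef, hedef]
        exact Nat.not_dvd_ordCompl hp.out hm0
      have hd0 : d ≠ 0 := fun h ↦ hm0 (by rw [hmd, h, mul_zero])
      haveI : NeZero d := ⟨hd0⟩
      have hdlt : d < m := by
        rw [hmd]
        have hp1 : 1 < p ^ (k + 1) := Nat.one_lt_pow (Nat.succ_ne_zero k) hp.out.one_lt
        calc d = 1 * d := (one_mul d).symm
          _ < p ^ (k + 1) * d := Nat.mul_lt_mul_of_pos_right hp1 (Nat.pos_of_ne_zero hd0)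
      obtain ⟨𝔓, h𝔓, hI𝔓⟩ := hI p hp.out
      have hψd := factorsThrough_of_factorsThrough_mul ψ hmd hpd hψ h𝔓 hI𝔓
      exact ih d hdlt hψd

/-! ## §3. The theorem -/

/-- **(G-ℚ): a continuous character of `Γ_ℚ` with values in a commutative group that kills an inertia group above every
prime is trivial** — «ℚ has no non-trivial abelian extension unramified at all finite primes» (Minkowski / Kronecker–Weber).
For `ψ : Γ_ℚ →* M` with OPEN kernel: by the tree's Kronecker–Weber theorem (`KroneckerWeber_holds`) `ψ` factors through
`Gal(ℚ(μ_m)/ℚ)`, i.e. through `χ_m` (`exists_forall_smul_eq_self_imp_eq_one_of_isKroneckerWeber`), and §2 applies. The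
hypothesis asks for ONE prime `𝔓 ∣ v` per place; the all-primes form is the tree's
`Mazur1978.monoidHom_eq_one_of_forall_inertia` (Cassels 10.12.1 route).
[cite: Washington1997, Ch. 14, Thm. 14.1] [cite: NeukirchANT1999, Ch. III Thm. (2.17), Cor. (2.18)] -/
theorem monoidHom_eq_one_of_forall_exists_inertia {M : Type*} [CommGroup M] (ψ : absoluteGaloisGroup ℚ →* M)
    (hker : IsOpen ((ψ.ker : Subgroup (absoluteGaloisGroup ℚ)) : Set (absoluteGaloisGroup ℚ)))
    (hI : ∀ v : HeightOneSpectrum (𝓞 ℚ), ∃ 𝔓 ∈ v.primesAbove, ∀ τ ∈ 𝔓.inertia (absoluteGaloisGroup ℚ), ψ τ = 1) :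
    ψ = 1 := by
  obtain ⟨m, hm, hfix⟩ := exists_forall_smul_eq_self_imp_eq_one_of_isKroneckerWeber KroneckerWeber_holds ψ hker
  haveI : NeZero m := ⟨hm.ne'⟩
  refine eq_one_of_factorsThrough_of_forall_inertia ψ (fun p hp ↦ hI _) m fun σ hσ ↦ hfix σ fun ζ hζ ↦ ?_
  rw [modNCyclotomicCharacter_spec ℚ m σ ζ hζ, hσ, Units.val_one]
  rcases Nat.lt_or_ge 1 m with h1 | h1
  · rw [ZMod.val_one'' h1.ne', pow_one]
  · have hm1 : m = 1 := le_antisymm h1 hm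
    subst hm1
    rw [pow_one] at hζ
    rw [hζ, one_pow]

/-- **(G-ℚ) in the Greenberg–Selmer currency**: a character of `Γ_ℚ` with open kernel that kills, for every finite place
`v`, the inertia group `GreenbergSelmer.inertia v ≤ Γ_ℚ` (the image of `absInertia ℚ_v` under `absGaloisRestrict ℚ ℚ_v`,
= `I_{𝔓₀}` for the prime `𝔓₀ = adicCompletionPrime ℚ v` cut out by the chosen embedding,
`inertia_adicCompletionPrime_eq_map_absInertia`) is trivial. [cite: NeukirchANT1999, Ch. III Thm. (2.17), Cor. (2.18)] -/
theorem monoidHom_eq_one_of_forall_greenbergInertia {M : Type*} [CommGroup M] (ψ : absoluteGaloisGroup ℚ →* M)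
    (hker : IsOpen ((ψ.ker : Subgroup (absoluteGaloisGroup ℚ)) : Set (absoluteGaloisGroup ℚ)))
    (hI : ∀ (v : HeightOneSpectrum (𝓞 ℚ)), ∀ τ ∈ GreenbergSelmer.inertia (K := ℚ) v, ψ τ = 1) :
    ψ = 1 := by
  refine monoidHom_eq_one_of_forall_exists_inertia ψ hker fun v ↦
    ⟨adicCompletionPrime ℚ v, adicCompletionPrime_mem_primesAbove ℚ v, fun τ hτ ↦ hI v τ ?_⟩
  rw [inertia_adicCompletionPrime_eq_map_absInertia ℚ v] at hτ
  exact hτ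

end Summit.BirchSwinnertonDyer.BirchSwinnertonDyer.Theorems.FullDescentNoUnramifiedCharacter

end
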